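import Mathlib
import Summits.Ventures.PercRepro2.TypedMarkedSeriesDefs
import Summits.Ventures.PercRepro2.TypedMarkedSeriesGraph

/-!
# Marked series vertices of degree two: the state lemmas of rules C and D (blind cell PercRepro2,
night-3 g13, 2026-08-27; `proofs/NIGHT3-CERT.md` §22)

`st_modelC`: `o` with exactly the edges `e = {a₁, o}` (bit `p`), `f = {o, a₂}` (bit `a`);
`st_modelD`: `b` with exactly the edges `e = {a₁, b}` (bit `p`), `f = {b, a₂}` (bit `a`).  The
state of `x[e ↦ p][f ↦ a]` is the model of the signature of `x[e ↦ closed][f ↦ closed]` — the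
seven coordinates by `conn_off_mid` (connections off the vertex) and `conn_mid_iff` (the vertex).
-/

namespace Summit.Ventures.PercRepro2

open UnionCluster

namespace CovForm

namespace MarkedSeries

open OneTyped TypedA3 Untouched TypedRed

/-! ## Propositional shapes -/

section Shapes

/-- `A ∨ (M ∧ (A ∨ B)) ↔ A ∨ (M ∧ B)`. -/
lemma shape_left {A B M : Prop} : A ∨ (M ∧ (A ∨ B)) ↔ A ∨ (M ∧ B) := by
  constructor
  · rintro (h | ⟨hm, h | h⟩)
    · exact Or.inl h
    · exact Or.inl h
    · exact Or.inr ⟨hm, h⟩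
  · rintro (h | ⟨hm, h⟩)
    · exact Or.inl h
    · exact Or.inr ⟨hm, Or.inr h⟩

/-- `B ∨ (M ∧ (A ∨ B)) ↔ B ∨ (M ∧ A)`. -/
lemma shape_right {A B M : Prop} : B ∨ (M ∧ (A ∨ B)) ↔ B ∨ (M ∧ A) := by
  constructor
  · rintro (h | ⟨hm, h | h⟩)
    · exact Or.inl h
    · exact Or.inr ⟨hm, h⟩
    · exact Or.inl h
  · rintro (h | ⟨hm, h⟩)
    · exact Or.inl h
    · exact Or.inr ⟨hm, Or.inl h⟩

end Shapes

/-! ## Rule C -/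

section StateC

open Classical

variable {V : Type*} {E : Type*} [DecidableEq E]
variable (ends : E → Sym2 V) (o a₁ a₂ a₃ b : V)

/-- **State lemma C**: `o` with exactly the edges `e = {a₁, o}` and `f = {o, a₂}`. -/
lemma st_modelC {e f : E} (hef : e ≠ f) (he : ends e = s(a₁, o)) (hf : ends f = s(o, a₂))
    (ho1 : o ≠ a₁) (ho2 : o ≠ a₂) (ho3 : o ≠ a₃) (hob : o ≠ b) (x : Config E)
    (hother : ∀ e', e' ≠ e → e' ≠ f → o ∈ ends e' → x e' = false) (p a : Bool) :
    st ends o a₁ a₂ a₃ b (Function.update (Function.update x e p) f a) =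
      modelC (decide (Conn ends (Function.update (Function.update x e false) f false) a₁ a₂))
        (decide (Conn ends (Function.update (Function.update x e false) f false) a₁ b))
        (decide (Conn ends (Function.update (Function.update x e false) f false) a₁ a₃))
        (decide (Conn ends (Function.update (Function.update x e false) f false) a₂ b))
        (decide (Conn ends (Function.update (Function.update x e false) f false) a₂ a₃))
        (decide (Conn ends (Function.update (Function.update x e false) f false) b a₃)) p a := by
  have off := fun {s t : V} (hs : s ≠ o) (ht : t ≠ o) =>
    conn_off_mid hef he hf ho1 ho2 x hother p a hs ht
  have mid := fun {s : V} (hs : s ≠ o) => conn_mid_iff hef he hf ho1 ho2 x hother p a hs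
  set x₀ := Function.update (Function.update x e false) f false with hx₀
  set x' := Function.update (Function.update x e p) f a with hx'
  have r1 : Conn ends x₀ a₁ a₁ := conn_refl ends x₀ a₁
  have r2 : Conn ends x₀ a₂ a₂ := conn_refl ends x₀ a₂
  have r1' : Conn ends x' a₁ a₁ := conn_refl ends x' a₁
  have r2' : Conn ends x' a₂ a₂ := conn_refl ends x' a₂
  have s21 : Conn ends x₀ a₂ a₁ ↔ Conn ends x₀ a₁ a₂ := ⟨conn_symm, conn_symm⟩
  have sb1 : Conn ends x₀ b a₁ ↔ Conn ends x₀ a₁ b := ⟨conn_symm, conn_symm⟩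
  have sb2 : Conn ends x₀ b a₂ ↔ Conn ends x₀ a₂ b := ⟨conn_symm, conn_symm⟩
  have s31 : Conn ends x₀ a₃ a₁ ↔ Conn ends x₀ a₁ a₃ := ⟨conn_symm, conn_symm⟩
  have s32 : Conn ends x₀ a₃ a₂ ↔ Conn ends x₀ a₂ a₃ := ⟨conn_symm, conn_symm⟩
  have hoff21 := off ho2.symm ho1.symm
  have hoff12 := off ho1.symm ho2.symm
  have hoff1b := off ho1.symm hob.symm
  have hoff2b := off ho2.symm hob.symm
  have hoff13 := off ho1.symm ho3.symm
  have hoff23 := off ho2.symm ho3.symm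
  have hmid1 := mid ho1.symm
  have hmid2 := mid ho2.symm
  simp only [st, modelC, Prod.mk.injEq]
  refine ⟨?_, ?_, ?_, ?_, ?_, ?_, ?_⟩
  · apply Bool.eq_iff_iff.mpr
    simp only [decide_eq_true_eq, Bool.or_eq_true, Bool.and_eq_true]
    simp only [hoff21, s21, r1, r2, true_or, or_true, and_true]
  · apply Bool.eq_iff_iff.mpr
    simp only [decide_eq_true_eq, Bool.or_eq_true, Bool.and_eq_true]
    simp only [hmid1, hoff12, r1', r1, r2, true_or, or_true, and_true]
  · apply Bool.eq_iff_iff.mpr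
    simp only [decide_eq_true_eq, Bool.or_eq_true, Bool.and_eq_true]
    simp only [hmid2, hoff21, s21, r2', r1, r2, true_or, or_true, and_true]
    exact or_comm
  · apply Bool.eq_iff_iff.mpr
    simp only [decide_eq_true_eq, Bool.or_eq_true, Bool.and_eq_true]
    simp only [hoff1b, sb1, sb2, r1, true_or, true_and]
    exact shape_left
  · apply Bool.eq_iff_iff.mpr
    simp only [decide_eq_true_eq, Bool.or_eq_true, Bool.and_eq_true]
    simp only [hoff2b, sb1, sb2, r2, or_true, true_and]
    exact shape_right
  · apply Bool.eq_iff_iff.mpr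
    simp only [decide_eq_true_eq, Bool.or_eq_true, Bool.and_eq_true]
    simp only [hoff13, s31, s32, r1, true_or, true_and]
    exact shape_left
  · apply Bool.eq_iff_iff.mpr
    simp only [decide_eq_true_eq, Bool.or_eq_true, Bool.and_eq_true]
    simp only [hoff23, s31, s32, r2, or_true, true_and]
    exact shape_right

end StateC

/-! ## Rule D -/

section StateD

open Classical

variable {V : Type*} {E : Type*} [DecidableEq E]
variable (ends : E → Sym2 V) (o a₁ a₂ a₃ b : V)

/-- **State lemma D**: `b` with exactly the edges `e = {a₁, b}` and `f = {b, a₂}`. -/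
lemma st_modelD {e f : E} (hef : e ≠ f) (he : ends e = s(a₁, b)) (hf : ends f = s(b, a₂))
    (hb1 : b ≠ a₁) (hb2 : b ≠ a₂) (hb3 : b ≠ a₃) (hbo : b ≠ o) (x : Config E)
    (hother : ∀ e', e' ≠ e → e' ≠ f → b ∈ ends e' → x e' = false) (p a : Bool) :
    st ends o a₁ a₂ a₃ b (Function.update (Function.update x e p) f a) =
      modelD (decide (Conn ends (Function.update (Function.update x e false) f false) a₁ a₂))
        (decide (Conn ends (Function.update (Function.update x e false) f false) a₁ o))
        (decide (Conn ends (Function.update (Function.update x e false) f false) a₁ a₃))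
        (decide (Conn ends (Function.update (Function.update x e false) f false) a₂ o))
        (decide (Conn ends (Function.update (Function.update x e false) f false) a₂ a₃))
        (decide (Conn ends (Function.update (Function.update x e false) f false) o a₃)) p a := by
  have off := fun {s t : V} (hs : s ≠ b) (ht : t ≠ b) =>
    conn_off_mid hef he hf hb1 hb2 x hother p a hs ht
  have mid := fun {s : V} (hs : s ≠ b) => conn_mid_iff hef he hf hb1 hb2 x hother p a hs
  set x₀ := Function.update (Function.update x e false) f false with hx₀
  set x' := Function.update (Function.update x e p) f a with hx'
  have r1 : Conn ends x₀ a₁ a₁ := conn_refl ends x₀ a₁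
  have r2 : Conn ends x₀ a₂ a₂ := conn_refl ends x₀ a₂
  have r1' : Conn ends x' a₁ a₁ := conn_refl ends x' a₁
  have r2' : Conn ends x' a₂ a₂ := conn_refl ends x' a₂
  have s21 : Conn ends x₀ a₂ a₁ ↔ Conn ends x₀ a₁ a₂ := ⟨conn_symm, conn_symm⟩
  have so1 : Conn ends x₀ o a₁ ↔ Conn ends x₀ a₁ o := ⟨conn_symm, conn_symm⟩
  have so2 : Conn ends x₀ o a₂ ↔ Conn ends x₀ a₂ o := ⟨conn_symm, conn_symm⟩
  have s31 : Conn ends x₀ a₃ a₁ ↔ Conn ends x₀ a₁ a₃ := ⟨conn_symm, conn_symm⟩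
  have s32 : Conn ends x₀ a₃ a₂ ↔ Conn ends x₀ a₂ a₃ := ⟨conn_symm, conn_symm⟩
  have hoff21 := off hb2.symm hb1.symm
  have hoff12 := off hb1.symm hb2.symm
  have hoff1o := off hb1.symm hbo.symm
  have hoff2o := off hb2.symm hbo.symm
  have hoff13 := off hb1.symm hb3.symm
  have hoff23 := off hb2.symm hb3.symm
  have hmid1 := mid hb1.symm
  have hmid2 := mid hb2.symm
  simp only [st, modelD, Prod.mk.injEq]
  refine ⟨?_, ?_, ?_, ?_, ?_, ?_, ?_⟩
  · apply Bool.eq_iff_iff.mpr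
    simp only [decide_eq_true_eq, Bool.or_eq_true, Bool.and_eq_true]
    simp only [hoff21, s21, r1, r2, true_or, or_true, and_true]
  · apply Bool.eq_iff_iff.mpr
    simp only [decide_eq_true_eq, Bool.or_eq_true, Bool.and_eq_true]
    simp only [hoff1o, so1, so2, r1, true_or, true_and]
    exact shape_left
  · apply Bool.eq_iff_iff.mpr
    simp only [decide_eq_true_eq, Bool.or_eq_true, Bool.and_eq_true]
    simp only [hoff2o, so1, so2, r2, or_true, true_and]
    exact shape_right
  · apply Bool.eq_iff_iff.mpr
    simp only [decide_eq_true_eq, Bool.or_eq_true, Bool.and_eq_true]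
    simp only [hmid1, hoff12, r1', r1, r2, true_or, or_true, and_true]
  · apply Bool.eq_iff_iff.mpr
    simp only [decide_eq_true_eq, Bool.or_eq_true, Bool.and_eq_true]
    simp only [hmid2, hoff21, s21, r2', r1, r2, true_or, or_true, and_true]
    exact or_comm
  · apply Bool.eq_iff_iff.mpr
    simp only [decide_eq_true_eq, Bool.or_eq_true, Bool.and_eq_true]
    simp only [hoff13, s31, s32, r1, true_or, true_and]
    exact shape_left
  · apply Bool.eq_iff_iff.mpr
    simp only [decide_eq_true_eq, Bool.or_eq_true, Bool.and_eq_true]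
    simp only [hoff23, s31, s32, r2, or_true, true_and]
    exact shape_right

end StateD

end MarkedSeries

end CovForm

end Summit.Ventures.PercRepro2
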